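import Summits.CriticalPhenomena.PercolationContinuityZ3.Theorems.PercNearOneGluingNoHeavyLowerTailThreePartitionCubeCheck

/-!
# Twisted three-partition positivity (★★) = (M⁺-3) on SIX letters: two small table facts for `m = 6` (computational)

Support file (cell `prim-sahi`, seat `prim-sahi-typer` gen 34; `--supports stmt-CriticalPhenomena-4575`, COMPUTATIONAL).  Two `native_decide`
evaluations about the tables of `…ThreePartitionCubeCheck` at `m = 6`, consumed by the soundness chain of the pair-saturation checker:
* `hpow_six` — the numeric identity `2 <<< pc 6 r = 2·#{s < 64 : s ⊆ r}` for all codes `r < 64` (hypothesis `hpow` of `profileArr_encA`);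
* `chainId_six` — the classes of the symmetric-chain-decomposition table `chainId` of `mkTabs 6` are chains of codes, with ids `< 64`
  (hypothesis `ChainIdOK 6` of the chain bound). [this work] [computational]
-/

namespace Summit.CriticalPhenomena.PercolationContinuityZ3.Theorems.ThreePartition.Cube

/-- `2 <<< |r| = 2 · #{s ⊆ r}` for the 64 codes of `2^[6]` (`native_decide`). [this work] [computational] -/
theorem hpow_six : ∀ r < 2 ^ 6, 2 <<< pc 6 r = 2 * ((List.range (2 ^ 6)).filter fun s => sub s r).length := by native_decide

/-- The `chainId` classes of `mkTabs 6` are chains, with ids `< 64` (`native_decide`). [this work] [computational] -/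
theorem chainId_six :
    (∀ a < 2 ^ 6, ∀ b < 2 ^ 6, (mkTabs 6).chainId.getD a 0 = (mkTabs 6).chainId.getD b 0 → sub a b = true ∨ sub b a = true) ∧
      ∀ a < 2 ^ 6, (mkTabs 6).chainId.getD a 0 < 2 ^ 6 := by
  native_decide

end Summit.CriticalPhenomena.PercolationContinuityZ3.Theorems.ThreePartition.Cube
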